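import Summits.QuantumAdvantage.QuantumAdvantage.Theses.LinnikCubicClassGroups
import Summits.QuantumAdvantage.QuantumAdvantage.Theorems.LinnikCubicClassGroupsDegreeOnePrimesEscapeUpperShadow
import Summits.QuantumAdvantage.QuantumAdvantage.Theorems.LinnikCubicClassGroupsDegreeOnePrimesEscapeLowerShadow
import Summits.QuantumAdvantage.QuantumAdvantage.Theorems.LinnikCubicClassGroupsDegreeOnePrimesEscapeComposition
import Summits.QuantumAdvantage.QuantumAdvantage.Theorems.LinnikCubicClassGroupsDegreeOnePrimesEscapeAdditiveOfTZ
import Summits.QuantumAdvantage.QuantumAdvantage.Theorems.LinnikCubicClassGroupsDegreeOnePrimesEscapeUpperShadowAdd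
import Summits.QuantumAdvantage.QuantumAdvantage.Theorems.LinnikCubicClassGroupsDegreeOnePrimesEscapeLowerShadowAdd
import Literature.NumberTheory.LFunctions.StarkNoQuadraticSubfieldProofs
import HarnessLib

/-!
# Crux `DegreeOnePrimesEscape` (stmt-QuantumAdvantage-11543): the crux from the Thorner–Zaman fact alone

Route `LinnikCubicClassGroups`, crux
`Summit.QuantumAdvantage.QuantumAdvantage.Theses.LinnikCubicClassGroups.DegreeOnePrimesEscape`
(`∀ n, ∃ C, ∀ K` of degree `n` without quadratic subfield, `∀ x ≥ |d_K|^C`, `∀ M < Cl(𝓞 K)` proper: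
`π(x) ≤ 8 · #{P : N P prime ≤ x, [P] ∉ M}`).

**CONDITIONAL RESULT.** `degreeOnePrimesEscape_of_additive` proves the crux BY NAME from the ADDITIVE class
prime number theorem dichotomy (the weakest form the dock consumes: per class `C` and `x ≥ Q^{c₁}`,
`|π_C(x) − m_C(x)/h| ≤ Li(x)/(32h)`, `m_C = Li(x)` or `Li(x) − Re χ₁(C)·Li(x^{β₁})` — provable without
Deuring–Heilbronn repulsion; the one remaining debt of the crux, registered stub `stub_classPNTAdditive` of line
`dedekind-s3-collision`), and `degreeOnePrimesEscape_of_TZ` from the single named Literature fact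
`Literature.NumberTheory.LFunctions.NumberField.ThornerZaman2019_classPNT_hilbertClassField` (Thorner–Zaman 2019,
Thm 1.4, for the Hilbert class field of a number field of any degree; UNPROVED in the tree), which implies the
additive form (`stub_additiveOfTZ`).  The second analytic input of the paper proof, Stark's
no-quadratic-subfield non-vanishing (Stark 1974 Thm 3 / Murty–Murty Ch. 2 Cor. 6.2), is no longer a
hypothesis: it is the tree theorem `Stark1974_dedekindZeta_ne_zero_of_noQuadraticSubfield_holds`
(`Literature/NumberTheory/LFunctions/StarkNoQuadraticSubfieldProofs.lean`, landed by this line), used here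
in the inexplicit form `∀ n, ∃ c > 0, …` with `c = 1/(4·n!)` (`starkInexplicit_holds`).  The proof is the
dock of line `dedekind-s3-collision`: `stub_upperShadowAdd` (additive ⇒ `32·[Cl:M]·#{𝔭 ∈ M} ≤ 33·Li`),
`stub_lowerShadowAdd` (additive + Stark ⇒ `29·Li ≤ 32·π_K`), `stub_shadowsComposition` (shadows ⇒ crux, pure
counting), `stub_additiveOfTZ` (TZ ⇒ additive).  When either fact is discharged, append
`theorem degreeOnePrimesEscape_proof : DegreeOnePrimesEscape := degreeOnePrimesEscape_of_additive …` (or `…_of_TZ …_holds`).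
-/

noncomputable section

open scoped NumberField nonZeroDivisors
open Literature.NumberTheory.LFunctions Literature.NumberTheory.LFunctions.NumberField

namespace Summit.QuantumAdvantage.QuantumAdvantage.Theorems.DegreeOnePrimesEscape

/-- **Stark's no-quadratic-subfield non-vanishing, inexplicit form, PROVED** (`c = 1/(4·n!)`, from the
tree theorem `Stark1974_dedekindZeta_ne_zero_of_noQuadraticSubfield_holds`): for every `n` there is `c > 0`
such that every number field `K` of degree `n` without quadratic subfield has `ζ_K(σ) ≠ 0` for
`1 − c/log|d_K| ≤ σ < 1`. -/
theorem starkInexplicit_holds :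
    ∀ n : ℕ, ∃ c : ℝ, 0 < c ∧ ∀ (K : Type) [Field K] [NumberField K], Module.finrank ℚ K = n →
      (∀ F : IntermediateField ℚ K, Module.finrank ℚ F ≠ 2) →
      ∀ σ : ℝ, 1 - c / Real.log ((NumberField.discr K).natAbs : ℝ) ≤ σ → σ < 1 →
        dedekindZetaCont K σ ≠ 0 := by
  intro n
  refine ⟨1 / (4 * (n.factorial : ℝ)), by positivity, fun K _ _ hK hnq σ hσ hσ1 => ?_⟩
  refine Stark1974_dedekindZeta_ne_zero_of_noQuadraticSubfield_holds K hnq σ ?_ hσ1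
  subst hK
  have h : 1 / (4 * ((Module.finrank ℚ K).factorial : ℝ)) /
        Real.log ((NumberField.discr K).natAbs : ℝ) =
      1 / (4 * ((Module.finrank ℚ K).factorial : ℝ) *
        Real.log ((NumberField.discr K).natAbs : ℝ)) := by
    rw [div_div]
  linarith [h]

/-- **The crux `DegreeOnePrimesEscape` from the ADDITIVE class prime number theorem dichotomy** (CONDITIONAL on
that statement — the registered open stub `stub_classPNTAdditive`; Stark's input is the proved `starkInexplicit_holds`). -/
theorem degreeOnePrimesEscape_of_additive
    (hAdd : (∃ c₁ : ℝ, 0 < c₁ ∧ ∀ (K : Type) [Field K] [NumberField K], 1 < Module.finrank ℚ K →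
      ((∀ (C : ClassGroup (𝓞 K)) (x : ℝ), ThornerZaman.condQn K ^ c₁ ≤ x →
          |(primeIdealClassCount K C x : ℝ) - offsetLogIntegral x / NumberField.classNumber K| ≤
            offsetLogIntegral x / (32 * NumberField.classNumber K)) ∨
        ∃ (χ₁ : ClassGroup (𝓞 K) →* ℂˣ) (β₁ : ℝ), χ₁ * χ₁ = 1 ∧
          1 - 1 / (8 * Real.log (ThornerZaman.condQn K)) < β₁ ∧ β₁ < 1 ∧
          classGroupLFunction K χ₁ β₁ = 0 ∧
          ∀ (C : ClassGroup (𝓞 K)) (x : ℝ), ThornerZaman.condQn K ^ c₁ ≤ x →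
            |(primeIdealClassCount K C x : ℝ) -
                (offsetLogIntegral x - ((χ₁ C : ℂ)).re * offsetLogIntegral (x ^ β₁)) /
                  NumberField.classNumber K| ≤
              offsetLogIntegral x / (32 * NumberField.classNumber K)))) :
    Summit.QuantumAdvantage.QuantumAdvantage.Theses.LinnikCubicClassGroups.DegreeOnePrimesEscape :=
  stub_shadowsComposition (stub_upperShadowAdd hAdd) (stub_lowerShadowAdd hAdd starkInexplicit_holds)

/-- **The crux `DegreeOnePrimesEscape` from the Thorner–Zaman fact ALONE** (CONDITIONAL on the named fact
`ThornerZaman2019_classPNT_hilbertClassField`, which implies the additive dichotomy: `stub_additiveOfTZ`). -/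
theorem degreeOnePrimesEscape_of_TZ (hTZ : ThornerZaman2019_classPNT_hilbertClassField) :
    Summit.QuantumAdvantage.QuantumAdvantage.Theses.LinnikCubicClassGroups.DegreeOnePrimesEscape :=
  degreeOnePrimesEscape_of_additive (stub_additiveOfTZ hTZ)

end Summit.QuantumAdvantage.QuantumAdvantage.Theorems.DegreeOnePrimesEscape

end
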